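import Summits.ResolutionOfSingularities.ResolutionOfSingularities.Theorems.PAlterationPicoverToRadicialBottomUnionRegular
import Summits.ResolutionOfSingularities.ResolutionOfSingularities.Theorems.PAlterationAssemblyLevels
import Literature.AlgebraicGeometry.Resolution.ProjectiveSpaceRegular

/-!
# `PAlteration.PicoverToRadicialBottom` (stmt-ResolutionOfSingularities-0556), line
`theta-finite-cofinite-roots`: the cofinite regular twist (glue)

Route `ResolutionOfSingularities/pAlteration`, crux `PicoverToRadicialBottom`; the lead's stub
`stub_cofiniteRegularTwistGlue` of the line skeleton: from the `p`-basis data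
(`stub_pBasisDerivations`), the extension of its derivations to finitely presented charts
(`stub_derivationQuotientMvPolynomial`), regularity of the finite root stages
(`stub_regularTensorAdjoinRoots`) and the directed-union lemma (`stub_directedUnionRegular`) — all
taken as hypotheses, by name of their statements — to: for `Z` regular of finite type over a
field `k` of characteristic `p` and `r ≥ 0`, a field `L ⊇ k` inside `k^{1/p^r}` with
`ψ : L → k`, `ψ(x) = x^{p^r}`, `k` FINITE over `ψ(L)`, and `Z ×ₖ Spec L` REGULAR. Construction:
a finite affine cover of `Z`, presentations of the charts and their coefficient set `C`, the
good-root field `L = k(u_i^{1/p^r})` inside the perfect closure with `ψ` read off the full level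
`k_r` (`exists_levelHom`), regularity of `L ⊗ₖ Γ(chart)` from the stages
(`isRegularRing_tensor_unionField`), and `Spec` of it as the charts of `Z ×ₖ Spec L`.
-/

noncomputable section

-- single-problem summit: the doubled namespace component `ResolutionOfSingularities` is forced
set_option linter.dupNamespace false

open scoped TensorProduct
open IntermediateField

namespace Summit.ResolutionOfSingularities.ResolutionOfSingularities.Theorems

/-! ## Glue (scheme side) -/

section Derivations

open AlgebraicGeometry

/-- Conjugating a derivation by a `k`-algebra isomorphism. [folklore] -/
theorem exists_derivation_conj {k : Type} [CommRing k] {Q R : Type} [CommRing Q] [CommRing R]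
    [Algebra k Q] [Algebra k R] (e : Q ≃ₐ[k] R) (D : Derivation ℤ Q Q) :
    ∃ D' : Derivation ℤ R R, ∀ x : Q, D' (e x) = e (D x) := by
  let f : R →ₗ[ℤ] R :=
    { toFun := fun x => e (D (e.symm x))
      map_add' := fun x y => by simp
      map_smul' := fun n x => by simp }
  refine ⟨Derivation.mk' f fun a b => ?_, fun x => ?_⟩
  · change e (D (e.symm (a * b))) = a • e (D (e.symm b)) + b • e (D (e.symm a))
    rw [map_mul, Derivation.leibniz, smul_eq_mul, smul_eq_mul, map_add, map_mul, map_mul,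
      smul_eq_mul, smul_eq_mul, AlgEquiv.apply_symm_apply, AlgEquiv.apply_symm_apply]
  · change e (D (e.symm (e x))) = e (D x)
    rw [AlgEquiv.symm_apply_apply]

/-- **Derivations of the constants extend to a finitely generated `k`-algebra once they kill the
coefficients of a presentation** (from `stub_derivationQuotientMvPolynomial`): there is a finite
set `C ⊆ k` such that every derivation of `k` vanishing on `C` extends compatibly to `A`.
[folklore] -/
theorem exists_coeffSet_derivations
    (hT3' : ∀ (k : Type) [CommRing k] (n : ℕ) (s : Finset (MvPolynomial (Fin n) k))
      (D : Derivation ℤ k k), (∀ f ∈ s, ∀ m, D (MvPolynomial.coeff m f) = 0) →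
      ∃ D' : Derivation ℤ (MvPolynomial (Fin n) k ⧸ Ideal.span (s : Set (MvPolynomial (Fin n) k)))
          (MvPolynomial (Fin n) k ⧸ Ideal.span (s : Set (MvPolynomial (Fin n) k))),
        ∀ a : k, D' (algebraMap k _ a) = algebraMap k _ (D a))
    (k : Type) [Field k] (A : Type) [CommRing A] [Algebra k A] [Algebra.FiniteType k A] :
    ∃ C : Finset k, ∀ D : Derivation ℤ k k, (∀ c ∈ C, D c = 0) →
      ∃ D' : Derivation ℤ A A, ∀ a : k, D' (algebraMap k A a) = algebraMap k A (D a) := by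
  classical
  haveI : Algebra.FinitePresentation k A := (Algebra.FinitePresentation.of_finiteType).mp ‹_›
  obtain ⟨n, f, hf, hker⟩ := Algebra.FinitePresentation.out (R := k) (A := A)
  obtain ⟨s, hs⟩ := hker
  refine ⟨s.biUnion MvPolynomial.coeffs, fun D hD => ?_⟩
  have hcoeff : ∀ g ∈ s, ∀ m, D (MvPolynomial.coeff m g) = 0 := by
    intro g hg m
    by_cases hm : m ∈ g.support
    · exact hD _ (Finset.mem_biUnion.mpr ⟨g, hg, MvPolynomial.mem_coeffs_iff.mpr ⟨m, hm, rfl⟩⟩)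
    · rw [MvPolynomial.notMem_support_iff.mp hm, map_zero]
  obtain ⟨D₁, hD₁⟩ := hT3' k n s D hcoeff
  have hs' : Ideal.span (s : Set (MvPolynomial (Fin n) k)) = RingHom.ker f.toRingHom := hs
  let e : (MvPolynomial (Fin n) k ⧸ Ideal.span (s : Set (MvPolynomial (Fin n) k))) ≃ₐ[k] A :=
    (Ideal.quotientEquivAlgOfEq k hs').trans (Ideal.quotientKerAlgEquivOfSurjective hf)
  obtain ⟨D', hD'⟩ := exists_derivation_conj e D₁
  refine ⟨D', fun a => ?_⟩
  rw [← e.commutes a, hD']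
  calc e (D₁ (algebraMap k _ a)) = e (algebraMap k _ (D a)) := congrArg e (hD₁ a)
    _ = algebraMap k A (D a) := e.commutes _

end Derivations

section FieldData

variable (p : ℕ) [Fact p.Prime] (k : Type) [Field k] [CharP k p] (r : ℕ) {G : Type} (u : G → k)

/-- `θ_i^{p^r} = u_i` for the roots `θ_i = u_i^{1/p^r}` in the perfect closure. [folklore] -/
theorem rootFamily_pow (i : G) :
    PerfectClosure.mk k p (r, u i) ^ p ^ r = PerfectClosure.of k p (u i) := by
  rw [← PerfectClosure.iterate_frobenius_mk k p r (u i), iterate_frobenius]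

/-- **The good-root field `L = k(u_i^{1/p^r} : i)` and its Frobenius `ψ : L → k`.** With
`L ⊆ k^{p^{-∞}}` the intermediate field generated by the `p^r`-th roots of the `u_i`: there is
`ψ : L → k` with `ψ(x) = x^{p^r}` (read in `L`), `ψ(a) = a^{p^r}` on `k`, and `ψ(θ_i) = u_i`; if
`k` is module-finite over `k^{p^r}[u_i : i]` then `ψ` is finite. [folklore] -/
theorem exists_frobeniusHom_adjoin_roots
    (hfin : Module.Finite (Subring.closure (Set.range (iterateFrobenius k p r) ∪ Set.range u)) k) :
    letI : Algebra k (PerfectClosure k p) := (PerfectClosure.of k p).toAlgebra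
    ∃ ψ : ↥(IntermediateField.adjoin k (Set.range fun i => PerfectClosure.mk k p (r, u i))) →+* k,
      (∀ x, algebraMap k _ (ψ x) = x ^ p ^ r) ∧ (∀ a : k, ψ (algebraMap k _ a) = a ^ p ^ r) ∧
        ψ.Finite := by
  letI : Algebra k (PerfectClosure k p) := (PerfectClosure.of k p).toAlgebra
  set L := IntermediateField.adjoin k (Set.range fun i => PerfectClosure.mk k p (r, u i)) with hL
  -- `L` lies in the level `k_r`
  set lev := Subfield.comap (iterateFrobenius (PerfectClosure k p) p r) (PerfectClosure.of k p).fieldRange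
  have hle : ∀ x : PerfectClosure k p, x ∈ L → x ∈ lev := by
    intro x hx
    have : L.toSubfield ≤ lev := by
      change Subfield.closure (Set.range (algebraMap k (PerfectClosure k p)) ∪ _) ≤ lev
      refine Subfield.closure_le.mpr ?_
      rintro y (⟨a, rfl⟩ | ⟨i, rfl⟩)
      · exact of_mem_level p k r a
      · exact (mem_level_iff p k r _).mpr ⟨u i, (rootFamily_pow p k r u i).symm⟩
    exact this hx
  obtain ⟨θr, -, hθr, hθrof⟩ := exists_levelHom p k r
  let ψ : ↥L →+* k :=
    { toFun := fun x => θr ⟨x.1, hle x.1 x.2⟩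
      map_one' := by
        have : (⟨((1 : ↥L) : PerfectClosure k p), hle _ (1 : ↥L).2⟩ : ↥lev) = 1 := Subtype.ext rfl
        rw [this, map_one]
      map_mul' := fun x y => by
        have : (⟨((x * y : ↥L) : PerfectClosure k p), hle _ (x * y).2⟩ : ↥lev) =
            ⟨x.1, hle x.1 x.2⟩ * ⟨y.1, hle y.1 y.2⟩ := Subtype.ext rfl
        rw [this, map_mul]
      map_zero' := by
        have : (⟨((0 : ↥L) : PerfectClosure k p), hle _ (0 : ↥L).2⟩ : ↥lev) = 0 := Subtype.ext rfl
        rw [this, map_zero]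
      map_add' := fun x y => by
        have : (⟨((x + y : ↥L) : PerfectClosure k p), hle _ (x + y).2⟩ : ↥lev) =
            ⟨x.1, hle x.1 x.2⟩ + ⟨y.1, hle y.1 y.2⟩ := Subtype.ext rfl
        rw [this, map_add] }
  have hof : Function.Injective (PerfectClosure.of k p) := (PerfectClosure.of k p).injective
  have hψ1 : ∀ x : ↥L, algebraMap k (↥L) (ψ x) = x ^ p ^ r := by
    intro x
    apply Subtype.ext
    change PerfectClosure.of k p (θr ⟨x.1, _⟩) = (x : PerfectClosure k p) ^ p ^ r
    rw [hθr]
  have hψ2 : ∀ a : k, ψ (algebraMap k (↥L) a) = a ^ p ^ r := fun a => hθrof a _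
  have hψu : ∀ i : G, ψ ⟨PerfectClosure.mk k p (r, u i),
      IntermediateField.subset_adjoin _ _ ⟨i, rfl⟩⟩ = u i := by
    intro i
    apply hof
    change PerfectClosure.of k p (θr ⟨PerfectClosure.mk k p (r, u i), _⟩) = _
    rw [hθr]
    exact rootFamily_pow p k r u i
  refine ⟨ψ, hψ1, hψ2, ?_⟩
  -- finiteness: the closure subring lies in the image of `ψ`
  set R₀ := Subring.closure (Set.range (iterateFrobenius k p r) ∪ Set.range u) with hR₀
  have hR₀le : ∀ z ∈ R₀, ∃ l : ↥L, ψ l = z := by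
    intro z hz
    have : R₀ ≤ ψ.range := by
      refine Subring.closure_le.mpr ?_
      rintro y (⟨a, rfl⟩ | ⟨i, rfl⟩)
      · exact ⟨algebraMap k (↥L) a, by rw [hψ2, iterateFrobenius_def]⟩
      · exact ⟨_, hψu i⟩
    obtain ⟨l, hl⟩ := this hz
    exact ⟨l, hl⟩
  letI := ψ.toAlgebra
  change Module.Finite (↥L) k
  obtain ⟨S, hS⟩ := Module.finite_def.mp hfin
  refine Module.finite_def.mpr ⟨S, ?_⟩
  rw [eq_top_iff]
  rintro x -
  have hx : x ∈ Submodule.span (↥R₀) (S : Set k) := by rw [hS]; exact Submodule.mem_top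
  induction hx using Submodule.span_induction with
  | mem y hy => exact Submodule.subset_span hy
  | zero => exact Submodule.zero_mem _
  | add y z _ _ hy hz => exact Submodule.add_mem _ hy hz
  | smul c y _ hy =>
    obtain ⟨l, hl⟩ := hR₀le c.1 c.2
    have : (c • y : k) = l • y := by
      change (c : k) * y = ψ l * y
      rw [hl]
    rw [this]
    exact Submodule.smul_mem _ l hy

end FieldData

section SchemeGlue

open CategoryTheory CategoryTheory.Limits AlgebraicGeometry TopologicalSpace
open Literature.AlgebraicGeometry.Resolution

-- as in Mathlib's pullback API for schemes
set_option backward.isDefEq.respectTransparency false in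
set_option maxHeartbeats 800000 in
/-- (lead) **Glue for the cofinite regular twist** — from the p-basis data (T3), the extension of
its derivations to finitely presented charts (T3'), regularity of the finite root stages (T4) and
the directed-union lemma (T5) to: for `Z` regular of finite type over `k` and `r`, a field
`L ⊇ k` inside `k^{1/p^r}` with `ψ : L → k` (`x ↦ x^{p^r}`) FINITE and `Z ×ₖ Spec L` regular
(affine cover of `Z`, presentations, coefficient set `C`, `L := k(θ_i)` inside the perfect
closure, `ψ` from the full level `θ_r`, regularity chartwise at every prime). [folklore] -/
theorem stub_cofiniteRegularTwistGlue :
    (∀ (p : ℕ) [Fact p.Prime] (k : Type) [Field k] [CharP k p] (C : Finset k) (r : ℕ),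
      ∃ (G : Type) (u : G → k) (D : G → Derivation ℤ k k),
        (∀ i, D i (u i) = 1) ∧ (∀ i j, i ≠ j → D i (u j) = 0) ∧ (∀ i, ∀ c ∈ C, D i c = 0) ∧
        Module.Finite (Subring.closure (Set.range (iterateFrobenius k p r) ∪ Set.range u)) k) →
    (∀ (k : Type) [CommRing k] (n : ℕ) (s : Finset (MvPolynomial (Fin n) k)) (D : Derivation ℤ k k),
      (∀ f ∈ s, ∀ m, D (MvPolynomial.coeff m f) = 0) →
      ∃ D' : Derivation ℤ (MvPolynomial (Fin n) k ⧸ Ideal.span (s : Set (MvPolynomial (Fin n) k)))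
          (MvPolynomial (Fin n) k ⧸ Ideal.span (s : Set (MvPolynomial (Fin n) k))),
        ∀ a : k, D' (algebraMap k _ a) = algebraMap k _ (D a)) →
    (∀ (p : ℕ) [Fact p.Prime] (k : Type) [Field k] [CharP k p] (A : Type) [CommRing A] [Algebra k A]
      [IsRegularRing A] (r : ℕ) (G : Type) (u : G → k) (D : G → Derivation ℤ A A),
      (∀ i, D i (algebraMap k A (u i)) = 1) → (∀ i j, i ≠ j → D i (algebraMap k A (u j)) = 0) →
      ∀ (E : Type) [Field E] [Algebra k E] (θ : G → E), (∀ i, θ i ^ p ^ r = algebraMap k E (u i)) →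
      ∀ S : Finset G,
        IsRegularRing (↥(IntermediateField.adjoin k (θ '' (S : Set G))) ⊗[k] A)) →
    (∀ (O : Type) [CommRing O] [IsLocalRing O] [IsNoetherianRing O] (ι : Type) (Oi : ι → Type)
      [∀ i, CommRing (Oi i)] [∀ i, IsLocalRing (Oi i)] (φ : ∀ i, Oi i →+* O),
      (∀ i, IsLocalHom (φ i)) → (∀ i, Function.Injective (φ i)) → (∀ i, (φ i).IsIntegral) →
      (∀ i, IsRegularLocalRing (Oi i)) →
      (∀ s : Finset O, ∃ i, (s : Set O) ⊆ Set.range (φ i)) →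
      IsRegularLocalRing O) →
    ∀ (p : ℕ) [Fact p.Prime] (k : Type) [Field k] [CharP k p] (Z : Scheme.{0})
      (fZ : Z ⟶ Spec (.of k)) [LocallyOfFiniteType fZ] [QuasiCompact fZ], Scheme.IsRegular Z →
      ∀ r : ℕ, ∃ (L : Type) (_ : Field L) (_ : Algebra k L) (ψ : L →+* k),
        (∀ x : L, algebraMap k L (ψ x) = x ^ p ^ r) ∧ (∀ a : k, ψ (algebraMap k L a) = a ^ p ^ r) ∧
        ψ.Finite ∧ Scheme.IsRegular (pullback fZ (Spec.map (CommRingCat.ofHom (algebraMap k L)))) := by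
  intro hT3 hT3' hT4 hT5 p _ k _ _ Z fZ _ _ hZ r
  classical
  letI instE : Algebra k (PerfectClosure k p) := (PerfectClosure.of k p).toAlgebra
  -- Step 1: a finite affine open cover of `Z` and its rings of sections as `k`-algebras
  haveI : CompactSpace Z := (HasAffineProperty.iff_of_isAffine (P := @QuasiCompact)).mp ‹_›
  let 𝒰 := Z.affineCover.finiteSubcover
  haveI hUaff : ∀ i, IsAffine (𝒰.X i) := fun i => by
    change IsAffine (Z.affineCover.X _); infer_instance
  let R : 𝒰.I₀ → Type := fun i => Γ(𝒰.X i, ⊤)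
  let φ : ∀ i, CommRingCat.of k ⟶ Γ(𝒰.X i, ⊤) := fun i =>
    Spec.preimage ((𝒰.X i).isoSpec.inv ≫ 𝒰.f i ≫ fZ)
  letI instR : ∀ i, Algebra k (R i) := fun i => (φ i).hom.toAlgebra
  have hSpec : ∀ i, Spec.map (CommRingCat.ofHom (algebraMap k (R i))) =
      (𝒰.X i).isoSpec.inv ≫ 𝒰.f i ≫ fZ := fun i => by
    change Spec.map (CommRingCat.ofHom (φ i).hom) = _
    rw [CommRingCat.ofHom_hom, Spec.map_preimage]
  haveI hft : ∀ i, Algebra.FiniteType k (R i) := fun i => by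
    have h : LocallyOfFiniteType (Spec.map (CommRingCat.ofHom (algebraMap k (R i)))) := by
      rw [hSpec]; infer_instance
    exact (HasRingHomProperty.Spec_iff (P := @LocallyOfFiniteType)).mp h
  haveI hnoeth : ∀ i, IsNoetherianRing (R i) := fun i => Algebra.FiniteType.isNoetherianRing k (R i)
  have hreg : ∀ i, IsRegularRing (R i) := fun i => by
    have h1 : Scheme.IsRegular (𝒰.X i) := fun x => by
      haveI := hZ ((𝒰.f i).base x)
      exact IsRegularLocalRing.of_ringEquiv (asIso ((𝒰.f i).stalkMap x)).commRingCatIsoToRingEquiv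
    have h2 : Scheme.IsRegular (Spec Γ(𝒰.X i, ⊤)) := Scheme.IsRegular.of_iso (𝒰.X i).isoSpec.hom h1
    exact (Scheme.isRegular_Spec_iff _).mp h2
  -- Step 2: the coefficient sets and the `p`-basis data
  choose C hC using fun i => exists_coeffSet_derivations hT3' k (R i)
  obtain ⟨G, u, D, hD1, hD2, hDC, hfin⟩ := hT3 p k (Finset.univ.biUnion C) r
  -- Step 3: the field `L` and `ψ`
  let θ : G → PerfectClosure k p := fun i => PerfectClosure.mk k p (r, u i)
  let L : IntermediateField k (PerfectClosure k p) := IntermediateField.adjoin k (Set.range θ)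
  obtain ⟨ψ, hψ1, hψ2, hψfin⟩ : ∃ ψ : ↥L →+* k, (∀ x, algebraMap k _ (ψ x) = x ^ p ^ r) ∧
      (∀ a : k, ψ (algebraMap k _ a) = a ^ p ^ r) ∧ ψ.Finite :=
    exists_frobeniusHom_adjoin_roots p k r u hfin
  have hθ : ∀ i, ∃ y : k, algebraMap k (PerfectClosure k p) y = θ i ^ p ^ r :=
    fun i => ⟨u i, (rootFamily_pow p k r u i).symm⟩
  -- Step 4: `L ⊗ R_i` is a regular ring for every chart
  have hregL : ∀ i, IsRegularRing ((R i) ⊗[k] ↥L) := fun i => by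
    -- derivations on `R i`
    have hDi : ∀ g : G, ∃ D' : Derivation ℤ (R i) (R i),
        ∀ a : k, D' (algebraMap k (R i) a) = algebraMap k (R i) (D g a) := fun g =>
      hC i (D g) fun c hc => hDC g c (Finset.mem_biUnion.mpr ⟨i, Finset.mem_univ _, hc⟩)
    choose DA hDA using hDi
    have hDA1 : ∀ g, DA g (algebraMap k (R i) (u g)) = 1 := fun g => by
      rw [hDA, hD1, map_one]
    have hDA2 : ∀ g g', g ≠ g' → DA g (algebraMap k (R i) (u g')) = 0 := fun g g' hgg' => by
      rw [hDA, hD2 g g' hgg', map_zero]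
    haveI := hreg i
    have hstages := hT4 p k (R i) r G u DA hDA1 hDA2 (PerfectClosure k p) θ
      (fun g => rootFamily_pow p k r u g)
    haveI : IsNoetherianRing (↥(IntermediateField.adjoin k (Set.range θ)) ⊗[k] R i) :=
      Algebra.FiniteType.isNoetherianRing (↥(IntermediateField.adjoin k (Set.range θ))) (↥(IntermediateField.adjoin k (Set.range θ)) ⊗[k] R i)
    have hmain := isRegularRing_tensor_unionField k θ (R i) p r hθ hT5 hstages
    exact IsRegularRing.of_ringEquiv (Algebra.TensorProduct.comm k (↥(IntermediateField.adjoin k (Set.range θ))) (R i)).toRingEquiv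
  -- Step 5: regularity of `Z ×ₖ Spec L`, chartwise
  refine ⟨↥L, inferInstance, inferInstance, ψ, hψ1, hψ2, hψfin, ?_⟩
  let iL := Spec.map (CommRingCat.ofHom (algebraMap k ↥L))
  change Scheme.IsRegular (pullback fZ iL)
  let 𝒱 := Scheme.Pullback.openCoverOfLeft 𝒰 fZ iL
  refine Scheme.IsRegular.of_forall_exists_isOpenImmersion fun y => ?_
  obtain ⟨i, y₀, hy₀⟩ := 𝒱.exists_eq y
  refine ⟨𝒱.X i, 𝒱.f i, inferInstance, ⟨y₀, hy₀⟩, ?_⟩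
  -- the chart `pullback (𝒰.f i ≫ fZ) iL ≅ Spec (R i ⊗ L)`
  change Scheme.IsRegular (pullback (𝒰.f i ≫ fZ) iL)
  haveI := hregL i
  have e1 : pullback (𝒰.f i ≫ fZ) iL ≅
      pullback (Spec.map (CommRingCat.ofHom (algebraMap k (R i)))) iL :=
    asIso (pullback.map (𝒰.f i ≫ fZ) iL (Spec.map (CommRingCat.ofHom (algebraMap k (R i)))) iL
      (𝒰.X i).isoSpec.hom (𝟙 _) (𝟙 _) (by rw [hSpec, Iso.hom_inv_id_assoc, Category.comp_id])
      (by rw [Category.comp_id, Category.id_comp]))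
  have e2 := pullbackSpecIso k (R i) ↥L
  exact Scheme.IsRegular.of_iso (e1 ≪≫ e2).inv (Scheme.isRegular_Spec (.of (R i ⊗[k] ↥L)))

end SchemeGlue

end Summit.ResolutionOfSingularities.ResolutionOfSingularities.Theorems

end
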